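import Mathlib
import HarnessLib
import Summits.ValiantsHypothesis.ValiantsHypothesis.Theorems.MonotoneRestorationOrbitRestorationQPMultiRowColumnAugmented
import Summits.ValiantsHypothesis.ValiantsHypothesis.Theorems.MonotoneRestorationOrbitRestorationQPTranspose

/-!
# Orbit sums of bounded-COLUMN-support ROW-symmetric patterns (augmented by the row sums) — the transposed class
# (route MonotoneRestoration, crux `OrbitRestorationQP` stmt-ValiantsHypothesis-18293; certified sub-class of the crux)

Namespace `Summit.ValiantsHypothesis.ValiantsHypothesis.Theorems.MultiRowColumnProducts`.  Definition-free.

Transpose twins (flat cost `+3`, `Transpose.qpOrbitRestorable_of_transpose`) of `qpOrbitRestorable_orbitSum_augmentedPattern`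
(`…MultiRowColumnAugmented.lean`): for every ROW-symmetric pattern `Ψ ∈ ℂ[X_{(a,s)} : a < n, s ∈ Fin k ⊕ Unit]` (invariant under
permuting `a`), the orbit sum over `k`-tuples of COLUMNS `h : Fin k → Fin n` of `Ψ(X_{(a, inl j)} ↦ x_{a h(j)}, X_{(a, inr ⋆)} ↦ R_a)`
(`R_a = Σ_b x_{ab}` the row sums) is `QPOrbitRestorable (2k + 12) n`:

* `rename_swap_aeval_augmentedPattern` — the transpose of the column-side evaluation is the row-side evaluation;
* `qpOrbitRestorable_orbitSum_augmentedPattern_cols` — **the transposed class is restorable.**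

With `…MultiRowColumnAugmented.lean` and the closure of `QPOrbitRestorable` under polynomial expressions in invariant restorables
(`qpOrbitRestorable_aeval_of_generators`), every polynomial in orbit sums of bounded-row-support column-symmetric patterns
(augmented by column sums) and of bounded-column-support row-symmetric patterns (augmented by row sums) is orbit-restorable.
Honest label: a stratum of the crux class; no stub closed; VP ≠ VNP untouched. [folklore]
[cite: Weyl1939, Chap. II §3, Thm (2.3.A); DawarWilsenach2025, §3.3]
-/

noncomputable section

open scoped Classical

-- `Summit.ValiantsHypothesis.ValiantsHypothesis.…` is the tree's single-conjunct layout (Sub = Summit).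
set_option linter.dupNamespace false

namespace Summit.ValiantsHypothesis.ValiantsHypothesis.Theorems.MultiRowColumnProducts

open MvPolynomial Equiv Literature.Computability.AlgebraicComplexity OrbitRestorationQPDepthThreeRung
  Summit.ValiantsHypothesis.ValiantsHypothesis.Theorems RowColumnTwoLevel

variable {n : ℕ}

/-- **Transposing the column-side evaluation gives the row-side evaluation.** [folklore] -/
theorem rename_swap_aeval_augmentedPattern {k : ℕ} (h : Fin k → Fin n) (Ψ : MvPolynomial (Fin n × (Fin k ⊕ Unit)) ℂ) :
    rename (Prod.swap : Fin n × Fin n → Fin n × Fin n)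
      (aeval (fun w : Fin n × (Fin k ⊕ Unit) =>
        (Sum.elim (fun j : Fin k => (X (h j, w.1) : MvPolynomial (Fin n × Fin n) ℂ))
          (fun _ : Unit => ∑ a : Fin n, (X (a, w.1) : MvPolynomial (Fin n × Fin n) ℂ)) w.2)) Ψ) =
      aeval (fun w : Fin n × (Fin k ⊕ Unit) =>
        (Sum.elim (fun j : Fin k => (X (w.1, h j) : MvPolynomial (Fin n × Fin n) ℂ))
          (fun _ : Unit => ∑ b : Fin n, (X (w.1, b) : MvPolynomial (Fin n × Fin n) ℂ)) w.2)) Ψ := by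
  rw [show rename (Prod.swap : Fin n × Fin n → Fin n × Fin n)
      (aeval (fun w : Fin n × (Fin k ⊕ Unit) =>
        (Sum.elim (fun j : Fin k => (X (h j, w.1) : MvPolynomial (Fin n × Fin n) ℂ))
          (fun _ : Unit => ∑ a : Fin n, (X (a, w.1) : MvPolynomial (Fin n × Fin n) ℂ)) w.2)) Ψ) =
    ((rename (Prod.swap : Fin n × Fin n → Fin n × Fin n)).comp (aeval fun w : Fin n × (Fin k ⊕ Unit) =>
        (Sum.elim (fun j : Fin k => (X (h j, w.1) : MvPolynomial (Fin n × Fin n) ℂ))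
          (fun _ : Unit => ∑ a : Fin n, (X (a, w.1) : MvPolynomial (Fin n × Fin n) ℂ)) w.2))) Ψ from rfl, comp_aeval]
  have hf : (fun w : Fin n × (Fin k ⊕ Unit) => (rename (Prod.swap : Fin n × Fin n → Fin n × Fin n))
      ((Sum.elim (fun j : Fin k => (X (h j, w.1) : MvPolynomial (Fin n × Fin n) ℂ))
        (fun _ : Unit => ∑ a : Fin n, (X (a, w.1) : MvPolynomial (Fin n × Fin n) ℂ)) w.2))) =
      (fun w : Fin n × (Fin k ⊕ Unit) =>
        (Sum.elim (fun j : Fin k => (X (w.1, h j) : MvPolynomial (Fin n × Fin n) ℂ))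
          (fun _ : Unit => ∑ b : Fin n, (X (w.1, b) : MvPolynomial (Fin n × Fin n) ℂ)) w.2)) := by
    funext w
    rcases w with ⟨a, s⟩
    rcases s with j | u
    · simp only [Sum.elim_inl, rename_X, Prod.swap_prod_mk]
    · simp only [Sum.elim_inr, map_sum, rename_X, Prod.swap_prod_mk]
  rw [hf]

/-- **ORBIT SUMS OF AUGMENTED ROW-SYMMETRIC `k`-COLUMN PATTERNS ARE RESTORABLE** (transpose twin, cost `+3`).  For every pattern
`Ψ ∈ ℂ[X_{(a,s)} : a < n, s ∈ Fin k ⊕ Unit]` invariant under permuting `a`,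
`Σ_{h : Fin k → Fin n} Ψ(X_{(a,inl j)} ↦ x_{a h(j)}, X_{(a,inr ⋆)} ↦ R_a)` is `QPOrbitRestorable (2k + 12) n`. [folklore] -/
theorem qpOrbitRestorable_orbitSum_augmentedPattern_cols (k : ℕ) (Ψ : MvPolynomial (Fin n × (Fin k ⊕ Unit)) ℂ)
    (hΨ : ∀ σ : Perm (Fin n), rename (fun w : Fin n × (Fin k ⊕ Unit) => (σ w.1, w.2)) Ψ = Ψ) :
    QPOrbitRestorable (2 * k + 12) n
      (∑ h : Fin k → Fin n, aeval (fun w : Fin n × (Fin k ⊕ Unit) =>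
        (Sum.elim (fun j : Fin k => (X (w.1, h j) : MvPolynomial (Fin n × Fin n) ℂ))
          (fun _ : Unit => ∑ b : Fin n, (X (w.1, b) : MvPolynomial (Fin n × Fin n) ℂ)) w.2)) Ψ) := by
  have hcol := qpOrbitRestorable_orbitSum_augmentedPattern (n := n) k Ψ hΨ
  have hT := Transpose.qpOrbitRestorable_transpose hcol
  rw [map_sum] at hT
  simp only [rename_swap_aeval_augmentedPattern] at hT
  have e : 2 * k + 9 + 3 = 2 * k + 12 := by omega
  rw [e] at hT
  exact hT

end Summit.ValiantsHypothesis.ValiantsHypothesis.Theorems.MultiRowColumnProducts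

end
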